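import Literature.Analysis.FluidPDE.MollifiedStartTriple
import Literature.Analysis.FluidPDE.HolderMollifiedField
import HarnessLib

/-!
# Sup bounds for the Navier–Stokes–Reynolds triple of a mollified Hölder field
# (Buckmaster–Vicol 2019, §2.5, (2.12)–(2.14))

Analysis/FluidPDE support file (serves the discharge of
`Literature.Barriers.AnomalousDissipation.BuckmasterVicol2019_mollifiedEulerStart`). For bounded
Hölder slab data `U` (`Torus.HolderSlabData U M H β T₀`), the scaled time bump `ρ_τ = (timeBump hτ).normed`,
`0 < ε ≤ 1/4` and a viscosity `ν`, the raw stress `Torus.startStressRaw (timeBump hτ) ε ν U t`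
(`= V ⊗ V - 𝒯 - ν(∇V + ∇Vᵀ)`) and its traceless part obey, at every `(t, x)` whose `τ`-window lies
in the slab (`m = max τ ε`, `C₁ = gradProfileMass d`, `C₂ = derivProfileMass d 2`,
`c = timeBumpDerivMass`):

* `‖raw(t, x) j‖ ≤ d (4MH m^β) + |ν| (2d ε⁻¹C₁ H m^β)` (`Torus.norm_startStressRaw_le`);
* `‖∂ₗ raw(t, x) j‖ ≤ 2dM ε⁻¹C₁Hm^β + d ε⁻¹C₁M² + |ν| 2d ε⁻²C₂M` (`Torus.norm_partialDeriv_startStressRaw_le`);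
* `‖∂ₜ raw(t, x) j‖ ≤ 2dM τ⁻¹cM + d τ⁻¹cM² + |ν| 2d τ⁻¹c ε⁻¹C₁M` (`Torus.norm_deriv_startStressRaw_le`);
* the traceless part costs a factor `card d + 1` (`Torus.tracelessCLM`, `Torus.norm_tracelessCLM_apply_le`),
  and the mollified velocity obeys `‖V‖ ≤ dM`, `‖∂ᵢV‖ ≤ d ε⁻¹C₁Hm^β`, `‖∂ₜV‖ ≤ d τ⁻¹cM`.

These are the sup-norm forms of BV's (2.12) `‖R̊_n‖_{C⁰} ≲ λ^{-1}M + λ^{-2β̄}M²` (here to first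
order in the Hölder modulus), (2.13) `‖R̊_n‖_{C¹_{t,x}} ≲ …λ`, (2.14) `‖v_n‖_{C¹_{t,x}} ≲ λ^{1-β̄}M`.

## Mathlib / tree search

All analytic input is `HolderMollifiedField` (component bounds) and `MollifiedStartTriple`
(the triple); here only finite-dimensional bookkeeping (`OnsagerCCFSEnergyProofs.norm_le_sum_norm_apply`,
`pi_norm_le_iff_of_nonneg`, `Torus.partialDeriv_smul`, `Torus.partialDeriv_clm_comp`,
`hasDerivAt_mollifiedField(_apply)`). One definition (`Torus.tracelessCLM`, the traceless part as a
continuous linear map on `d → ℝ^d`); no named facts.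

## References

* T. Buckmaster, V. Vicol, Ann. of Math. 189 (2019), §2.5 (2.12)–(2.14). [`BuckmasterVicol2019Annals`]
-/

noncomputable section

open MeasureTheory TopologicalSpace Set Function Filter Metric ContinuousLinearMap
open _root_.Topology
open scoped ENNReal NNReal Convolution InnerProductSpace ContDiff

namespace Literature.Analysis.FluidPDE

namespace Torus

open FunctionSpaces.Torus (stLift lift kernel IsSmooth IsContDiff IsDivFree mollifiedField vecMollify
  timeBump timeBumpDerivMass gradProfileMass derivProfileMass)
open FunctionSpaces (timeAvgWith)

variable {d : Type*} [Fintype d] [DecidableEq d]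

/-! ## The traceless part as a continuous linear map -/

section Traceless

/-- The traceless part of a tensor (stored by columns) as a linear map on `d → ℝ^d`:
`(L w) j = w j - ((∑ᵢ wᵢᵢ)/d) eⱼ`. [folklore] -/
def tracelessLin : (d → EuclideanSpace ℝ d) →ₗ[ℝ] (d → EuclideanSpace ℝ d) where
  toFun w := fun j => w j - ((∑ i, w i i) / Fintype.card d) • EuclideanSpace.single j (1 : ℝ)
  map_add' w w' := by
    funext j
    simp only [Pi.add_apply, PiLp.add_apply, Finset.sum_add_distrib, add_div, add_smul]
    abel
  map_smul' c w := by
    funext j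
    simp only [Pi.smul_apply, PiLp.smul_apply, smul_eq_mul, RingHom.id_apply, ← Finset.mul_sum, smul_sub,
      smul_smul, mul_div_assoc]

/-- The traceless part as a continuous linear map (finite dimension). [folklore] -/
def tracelessCLM : (d → EuclideanSpace ℝ d) →L[ℝ] (d → EuclideanSpace ℝ d) :=
  LinearMap.toContinuousLinearMap tracelessLin

omit [DecidableEq d] in
/-- Unfolding `tracelessCLM`. [folklore] -/
theorem tracelessCLM_apply [DecidableEq d] (w : d → EuclideanSpace ℝ d) (j : d) :
    tracelessCLM w j = w j - ((∑ i, w i i) / Fintype.card d) • EuclideanSpace.single j (1 : ℝ) := rfl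

/-- `traceless S = tracelessCLM ∘ S`. [folklore] -/
theorem traceless_eq_comp (S : UnitAddTorus d → d → EuclideanSpace ℝ d) : traceless S = tracelessCLM ∘ S := by
  funext x j
  rw [traceless_apply, Function.comp_apply, tracelessCLM_apply, tensorTrace]

/-- Column bound for the traceless part: `‖(L w) j‖ ≤ ‖w j‖ + ∑ᵢ ‖w i‖`. [folklore] -/
theorem norm_tracelessCLM_apply_le (w : d → EuclideanSpace ℝ d) (j : d) :
    ‖tracelessCLM w j‖ ≤ ‖w j‖ + ∑ i, ‖w i‖ := by
  rw [tracelessCLM_apply]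
  refine (norm_sub_le _ _).trans (add_le_add le_rfl ?_)
  rw [norm_smul, PiLp.norm_single, norm_one, mul_one, Real.norm_eq_abs, abs_div]
  have hd : (0 : ℝ) ≤ Fintype.card d := Nat.cast_nonneg _
  calc |∑ i, w i i| / |(Fintype.card d : ℝ)| ≤ |∑ i, w i i| := by
        rcases Nat.eq_zero_or_pos (Fintype.card d) with h | h
        · simp [h]
        · rw [abs_of_nonneg hd]
          exact div_le_self (abs_nonneg _) (by exact_mod_cast h)
    _ ≤ ∑ i, |w i i| := Finset.abs_sum_le_sum_abs _ _
    _ ≤ ∑ i, ‖w i‖ := Finset.sum_le_sum fun i _ => by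
        rw [← Real.norm_eq_abs]; exact PiLp.norm_apply_le (w i) i

/-- **The traceless part costs a factor `card d + 1`** in the sup (column) norm:
`‖L w‖ ≤ (card d + 1) ‖w‖`. [folklore] -/
theorem norm_tracelessCLM_le (w : d → EuclideanSpace ℝ d) : ‖tracelessCLM w‖ ≤ (Fintype.card d + 1) * ‖w‖ := by
  have h0 : 0 ≤ (Fintype.card d + 1) * ‖w‖ := by positivity
  refine (pi_norm_le_iff_of_nonneg h0).2 fun j => (norm_tracelessCLM_apply_le w j).trans ?_
  calc ‖w j‖ + ∑ i, ‖w i‖ ≤ ‖w‖ + ∑ _i : d, ‖w‖ :=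
        add_le_add (norm_le_pi_norm w j) (Finset.sum_le_sum fun i _ => norm_le_pi_norm w i)
    _ = (Fintype.card d + 1) * ‖w‖ := by rw [Finset.sum_const, Finset.card_univ, nsmul_eq_mul]; ring

end Traceless

/-! ## Vector forms of the velocity bounds -/

section Velocity

variable {U : ℝ → UnitAddTorus d → EuclideanSpace ℝ d} {M H β T₀ τ ε : ℝ}

/-- **`‖∂ᵢV‖ ≤ d C₁ ε⁻¹ H (max τ ε)^β`** on windows inside the slab (vector form of (2.14)). [cite: BuckmasterVicol2019Annals, §2.5 (2.14)] -/
theorem norm_partialDeriv_mollifiedField_le (hU : HolderSlabData U M H β T₀) (hτ : 0 < τ) (hε : 0 < ε)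
    (hε' : ε ≤ 1 / 4) {t : ℝ} (ht : Icc (t - τ) (t + τ) ⊆ Icc 0 T₀) (x : UnitAddTorus d) (i : d) :
    ‖FunctionSpaces.Torus.partialDeriv i (mollifiedField (timeBump hτ) ε U t) x‖ ≤
      Fintype.card d * (ε⁻¹ * gradProfileMass d * (H * max τ ε ^ β)) := by
  refine (norm_le_sum_norm_apply _).trans ?_
  calc ∑ k, ‖FunctionSpaces.Torus.partialDeriv i (mollifiedField (timeBump hτ) ε U t) x k‖
      ≤ ∑ _k : d, ε⁻¹ * gradProfileMass d * (H * max τ ε ^ β) :=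
        Finset.sum_le_sum fun k _ => norm_partialDeriv_mollifiedField_apply_le hU hτ hε hε' ht x i k
    _ = _ := by rw [Finset.sum_const, Finset.card_univ, nsmul_eq_mul]

omit [DecidableEq d] in
/-- **`‖∂ₜV‖ ≤ d c τ⁻¹ M`** (vector form). [cite: BuckmasterVicol2019Annals, §2.5 (2.14)] -/
theorem norm_timeDeriv_mollifiedField_le (hU : HolderSlabData U M H β T₀) (hτ : 0 < τ) (hε : 0 < ε)
    (hε' : ε ≤ 1 / 4) (t : ℝ) (x : UnitAddTorus d) :
    ‖FunctionSpaces.Torus.timeDeriv (mollifiedField (timeBump hτ) ε U) t x‖ ≤ Fintype.card d * (τ⁻¹ * timeBumpDerivMass * M) := by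
  classical
  refine (norm_le_sum_norm_apply _).trans ?_
  calc ∑ k, ‖FunctionSpaces.Torus.timeDeriv (mollifiedField (timeBump hτ) ε U) t x k‖
      ≤ ∑ _k : d, τ⁻¹ * timeBumpDerivMass * M :=
        Finset.sum_le_sum fun k _ => norm_timeDeriv_mollifiedField_apply_le hU hτ hε hε' t x k
    _ = _ := by rw [Finset.sum_const, Finset.card_univ, nsmul_eq_mul]

/-- `‖∇Vⱼ‖ ≤ d C₁ ε⁻¹ H (max τ ε)^β` on windows inside the slab. [folklore] -/
theorem norm_gradient_mollifiedField_apply_le (hU : HolderSlabData U M H β T₀) (hτ : 0 < τ) (hε : 0 < ε)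
    (hε' : ε ≤ 1 / 4) {t : ℝ} (ht : Icc (t - τ) (t + τ) ⊆ Icc 0 T₀) (x : UnitAddTorus d) (j : d) :
    ‖FunctionSpaces.Torus.gradient (fun y => mollifiedField (timeBump hτ) ε U t y j) x‖ ≤
      Fintype.card d * (ε⁻¹ * gradProfileMass d * (H * max τ ε ^ β)) := by
  have hUi := integrable_uncurry_of_bounded hU.measurable hU.bound hU.zero_off
  have hV : IsSmooth (mollifiedField (timeBump hτ) ε U t) := isSmooth_mollifiedField hUi hε hε' t
  refine (norm_le_sum_norm_apply _).trans ?_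
  calc ∑ i, ‖FunctionSpaces.Torus.gradient (fun y => mollifiedField (timeBump hτ) ε U t y j) x i‖
      ≤ ∑ _i : d, ε⁻¹ * gradProfileMass d * (H * max τ ε ^ β) := Finset.sum_le_sum fun i _ => by
        rw [FunctionSpaces.Torus.gradient_apply ((hV.apply j).isContDiff (by simp)),
          FunctionSpaces.Torus.partialDeriv_apply_coord (hV.isContDiff (by simp))]
        exact norm_partialDeriv_mollifiedField_apply_le hU hτ hε hε' ht x i j
    _ = _ := by rw [Finset.sum_const, Finset.card_univ, nsmul_eq_mul]

/-- **`‖(∇V + ∇Vᵀ) j‖ ≤ 2 d C₁ ε⁻¹ H (max τ ε)^β`** on windows inside the slab. [folklore] -/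
theorem norm_symGrad_mollifiedField_col_le (hU : HolderSlabData U M H β T₀) (hτ : 0 < τ) (hε : 0 < ε)
    (hε' : ε ≤ 1 / 4) {t : ℝ} (ht : Icc (t - τ) (t + τ) ⊆ Icc 0 T₀) (x : UnitAddTorus d) (j : d) :
    ‖symGrad (mollifiedField (timeBump hτ) ε U t) x j‖ ≤
      2 * (Fintype.card d * (ε⁻¹ * gradProfileMass d * (H * max τ ε ^ β))) := by
  show ‖FunctionSpaces.Torus.partialDeriv j (mollifiedField (timeBump hτ) ε U t) x +
      FunctionSpaces.Torus.gradient (fun y => mollifiedField (timeBump hτ) ε U t y j) x‖ ≤ _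
  rw [two_mul]
  exact (norm_add_le _ _).trans (add_le_add (norm_partialDeriv_mollifiedField_le hU hτ hε hε' ht x j)
    (norm_gradient_mollifiedField_apply_le hU hτ hε hε' ht x j))

end Velocity

/-! ## The raw stress: sup bound -/

section RawSup

variable {U : ℝ → UnitAddTorus d → EuclideanSpace ℝ d} {M H β T₀ τ ε : ℝ}

/-- **`‖(V ⊗ V - 𝒯 - ν(∇V + ∇Vᵀ)) j‖ ≤ d·4MH m^β + |ν|·2dC₁ε⁻¹H m^β`** on windows inside the slab
(Buckmaster–Vicol (2.12), to first order in the modulus, plus the viscous term). [cite: BuckmasterVicol2019Annals, §2.5 (2.12)] -/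
theorem norm_startStressRaw_le (hU : HolderSlabData U M H β T₀) (hτ : 0 < τ) (hε : 0 < ε) (hε' : ε ≤ 1 / 4)
    (ν : ℝ) {t : ℝ} (ht : Icc (t - τ) (t + τ) ⊆ Icc 0 T₀) (x : UnitAddTorus d) (j : d) :
    ‖startStressRaw (timeBump hτ) ε ν U t x j‖ ≤
      Fintype.card d * (4 * M * H * max τ ε ^ β) +
        |ν| * (2 * (Fintype.card d * (ε⁻¹ * gradProfileMass d * (H * max τ ε ^ β)))) := by
  have hAB : ‖tensorProd (mollifiedField (timeBump hτ) ε U t) (mollifiedField (timeBump hτ) ε U t) x j -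
      mollifiedFlux (timeBump hτ) ε U t x j‖ ≤ Fintype.card d * (4 * M * H * max τ ε ^ β) := by
    refine (norm_le_sum_norm_apply _).trans ?_
    calc ∑ i, ‖(tensorProd (mollifiedField (timeBump hτ) ε U t) (mollifiedField (timeBump hτ) ε U t) x j -
          mollifiedFlux (timeBump hτ) ε U t x j) i‖ ≤ ∑ _i : d, 4 * M * H * max τ ε ^ β :=
          Finset.sum_le_sum fun i _ => by
            rw [PiLp.sub_apply, tensorProd_apply, norm_sub_rev, mul_comm]
            exact norm_mollifiedFlux_sub_mul_le hU hτ hε hε' ht x j i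
      _ = _ := by rw [Finset.sum_const, Finset.card_univ, nsmul_eq_mul]
  have hG := norm_symGrad_mollifiedField_col_le hU hτ hε hε' ht x j
  calc ‖startStressRaw (timeBump hτ) ε ν U t x j‖
      ≤ ‖tensorProd (mollifiedField (timeBump hτ) ε U t) (mollifiedField (timeBump hτ) ε U t) x j -
          mollifiedFlux (timeBump hτ) ε U t x j‖ + ‖ν • symGrad (mollifiedField (timeBump hτ) ε U t) x j‖ :=
        norm_sub_le _ _
    _ ≤ _ := by
        rw [norm_smul, Real.norm_eq_abs]
        exact add_le_add hAB (mul_le_mul_of_nonneg_left hG (abs_nonneg ν))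

/-- **`‖R̊‖ ≤ (card d + 1) · column bound`**: the sup (column) norm of the traceless part of the
raw stress. [folklore] -/
theorem norm_traceless_startStressRaw_le (hU : HolderSlabData U M H β T₀) (hτ : 0 < τ) (hε : 0 < ε)
    (hε' : ε ≤ 1 / 4) (ν : ℝ) {t : ℝ} (ht : Icc (t - τ) (t + τ) ⊆ Icc 0 T₀) (x : UnitAddTorus d) :
    ‖traceless (startStressRaw (timeBump hτ) ε ν U t) x‖ ≤ (Fintype.card d + 1) *
      (Fintype.card d * (4 * M * H * max τ ε ^ β) +
        |ν| * (2 * (Fintype.card d * (ε⁻¹ * gradProfileMass d * (H * max τ ε ^ β))))) := by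
  rw [traceless_eq_comp, Function.comp_apply]
  refine (norm_tracelessCLM_le _).trans (mul_le_mul_of_nonneg_left ?_ (by positivity))
  have hm : 0 ≤ max τ ε ^ β := Real.rpow_nonneg (le_max_of_le_left hτ.le) _
  have h0 : 0 ≤ Fintype.card d * (4 * M * H * max τ ε ^ β) +
      |ν| * (2 * (Fintype.card d * (ε⁻¹ * gradProfileMass d * (H * max τ ε ^ β)))) := by
    have := hU.M_nonneg; have := hU.H_nonneg; have := FunctionSpaces.Torus.gradProfileMass_nonneg (d := d)
    positivity
  exact (pi_norm_le_iff_of_nonneg h0).2 fun j => norm_startStressRaw_le hU hτ hε hε' ν ht x j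

end RawSup

/-! ## The raw stress: space derivatives -/

section RawDeriv

variable {U : ℝ → UnitAddTorus d → EuclideanSpace ℝ d} {M H β T₀ τ ε : ℝ}

/-- Columns commute with partial derivatives of tensor fields: `(∂ₗS) j = ∂ₗ(S j)`. [folklore] -/
theorem partialDeriv_tensor_apply {S : UnitAddTorus d → d → EuclideanSpace ℝ d} (hS : IsSmooth S) (l : d)
    (x : UnitAddTorus d) (j : d) :
    FunctionSpaces.Torus.partialDeriv l S x j = FunctionSpaces.Torus.partialDeriv l (fun y => S y j) x := by
  have h := FunctionSpaces.Torus.partialDeriv_clm_comp hS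
    (ContinuousLinearMap.proj (R := ℝ) (φ := fun _ : d => EuclideanSpace ℝ d) j) l x
  exact h.symm

/-- **`‖∂ₗ (V ⊗ V - 𝒯 - ν(∇V + ∇Vᵀ)) j‖ ≤ 2dM C₁ε⁻¹Hm^β + d C₁ε⁻¹M² + |ν| 2d C₂ε⁻²M`** on windows
inside the slab (sup form of Buckmaster–Vicol (2.13), space part). [cite: BuckmasterVicol2019Annals, §2.5 (2.13)] -/
theorem norm_partialDeriv_startStressRaw_apply_le (hU : HolderSlabData U M H β T₀) (hτ : 0 < τ) (hε : 0 < ε)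
    (hε' : ε ≤ 1 / 4) (ν : ℝ) {t : ℝ} (ht : Icc (t - τ) (t + τ) ⊆ Icc 0 T₀) (x : UnitAddTorus d) (l j : d) :
    ‖FunctionSpaces.Torus.partialDeriv l (fun y => startStressRaw (timeBump hτ) ε ν U t y j) x‖ ≤
      2 * (Fintype.card d * M) * (ε⁻¹ * gradProfileMass d * (H * max τ ε ^ β)) +
        Fintype.card d * (ε⁻¹ * gradProfileMass d * M ^ 2) +
        |ν| * (2 * (Fintype.card d * ((ε ^ 2)⁻¹ * derivProfileMass d 2 * M))) := by
  have hUi := integrable_uncurry_of_bounded hU.measurable hU.bound hU.zero_off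
  set V := mollifiedField (timeBump hτ) ε U t with hV
  have hVs : IsSmooth V := isSmooth_mollifiedField hUi hε hε' t
  have hTs : IsSmooth (mollifiedFlux (timeBump hτ) ε U t) := isSmooth_mollifiedFlux hU.measurable hU.bound hU.zero_off hε hε' t
  have hGs : IsSmooth (symGrad V) := hVs.symGrad
  -- the three pieces as smooth functions of `y`
  have ha : IsSmooth fun y => V y j • V y := (hVs.apply j).smul' hVs
  have hb : IsSmooth fun y => mollifiedFlux (timeBump hτ) ε U t y j := hTs.column j
  have hg : IsSmooth fun y => symGrad V y j := hGs.column j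
  -- ∂ₗ of the column
  have hbn : IsSmooth fun y => -mollifiedFlux (timeBump hτ) ε U t y j := hb.neg
  have hsplit : (fun y => startStressRaw (timeBump hτ) ε ν U t y j) =
      ((fun y => V y j • V y) + fun y => -mollifiedFlux (timeBump hτ) ε U t y j) + (-ν) • fun y => symGrad V y j := by
    funext y
    simp only [startStressRaw, tensorProd, Pi.add_apply, Pi.smul_apply, Pi.neg_apply, neg_smul, ← hV]
    abel
  rw [hsplit, FunctionSpaces.Torus.partialDeriv_add ((ha.add hbn).isContDiff (by simp)) ((hg.smul (-ν)).isContDiff (by simp)),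
    Pi.add_apply, FunctionSpaces.Torus.partialDeriv_add (ha.isContDiff (by simp)) (hbn.isContDiff (by simp)), Pi.add_apply,
    FunctionSpaces.Torus.partialDeriv_const_smul (hg.isContDiff (by simp)), Pi.smul_apply,
    FunctionSpaces.Torus.partialDeriv_neg]
  -- bounds of the three pieces
  have hK := norm_partialDeriv_mollifiedField_le hU hτ hε hε' ht x l
  have h1 : ‖FunctionSpaces.Torus.partialDeriv l (fun y => V y j • V y) x‖ ≤
      2 * (Fintype.card d * M) * (ε⁻¹ * gradProfileMass d * (H * max τ ε ^ β)) := by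
    rw [FunctionSpaces.Torus.partialDeriv_smul ((hVs.apply j).isContDiff (by simp)) (hVs.isContDiff (by simp))]
    have hcoef : ‖FunctionSpaces.Torus.partialDeriv l (fun y => V y j) x‖ ≤ ε⁻¹ * gradProfileMass d * (H * max τ ε ^ β) := by
      rw [FunctionSpaces.Torus.partialDeriv_apply_coord (hVs.isContDiff (by simp))]
      exact norm_partialDeriv_mollifiedField_apply_le hU hτ hε hε' ht x l j
    have hVx : ‖V x‖ ≤ Fintype.card d * M := (norm_mollifiedField_bounds hU hτ hε hε').1 t x
    calc ‖V x j • FunctionSpaces.Torus.partialDeriv l V x + FunctionSpaces.Torus.partialDeriv l (fun y => V y j) x • V x‖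
        ≤ ‖V x j‖ * ‖FunctionSpaces.Torus.partialDeriv l V x‖ + ‖FunctionSpaces.Torus.partialDeriv l (fun y => V y j) x‖ * ‖V x‖ := by
          refine (norm_add_le _ _).trans (add_le_add ?_ ?_) <;> rw [norm_smul]
      _ ≤ M * (Fintype.card d * (ε⁻¹ * gradProfileMass d * (H * max τ ε ^ β))) +
            ε⁻¹ * gradProfileMass d * (H * max τ ε ^ β) * (Fintype.card d * M) :=
          add_le_add (mul_le_mul (norm_mollifiedField_apply_le hU hτ hε hε' t x j) hK (norm_nonneg _) hU.M_nonneg)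
            (mul_le_mul hcoef hVx (norm_nonneg _) (by
              have := hU.H_nonneg; have := FunctionSpaces.Torus.gradProfileMass_nonneg (d := d)
              have : 0 ≤ max τ ε ^ β := Real.rpow_nonneg (le_max_of_le_left hτ.le) _
              positivity))
      _ = _ := by ring
  have h2 : ‖FunctionSpaces.Torus.partialDeriv l (fun y => mollifiedFlux (timeBump hτ) ε U t y j) x‖ ≤
      Fintype.card d * (ε⁻¹ * gradProfileMass d * M ^ 2) := by
    refine (norm_le_sum_norm_apply _).trans ?_
    calc ∑ i, ‖FunctionSpaces.Torus.partialDeriv l (fun y => mollifiedFlux (timeBump hτ) ε U t y j) x i‖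
        ≤ ∑ _i : d, ε⁻¹ * gradProfileMass d * M ^ 2 :=
          Finset.sum_le_sum fun i _ => norm_partialDeriv_mollifiedFlux_apply_le hU hτ hε hε' t x l j i
      _ = _ := by rw [Finset.sum_const, Finset.card_univ, nsmul_eq_mul]
  have h3 : ‖FunctionSpaces.Torus.partialDeriv l (fun y => symGrad V y j) x‖ ≤
      2 * (Fintype.card d * ((ε ^ 2)⁻¹ * derivProfileMass d 2 * M)) := by
    have hsum : (fun y => symGrad V y j) = (FunctionSpaces.Torus.partialDeriv j V) +
        fun y => FunctionSpaces.Torus.gradient (fun y => V y j) y := rfl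
    rw [hsum, FunctionSpaces.Torus.partialDeriv_add ((hVs.partialDeriv j).isContDiff (by simp))
      ((hVs.apply j).gradient.isContDiff (by simp)), Pi.add_apply, two_mul]
    refine (norm_add_le _ _).trans (add_le_add ?_ ?_)
    · refine (norm_le_sum_norm_apply _).trans ?_
      calc ∑ i, ‖FunctionSpaces.Torus.partialDeriv l (FunctionSpaces.Torus.partialDeriv j V) x i‖
          ≤ ∑ _i : d, (ε ^ 2)⁻¹ * derivProfileMass d 2 * M :=
            Finset.sum_le_sum fun i _ => norm_partialDeriv_partialDeriv_mollifiedField_apply_le hU hτ hε hε' t x l j i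
        _ = _ := by rw [Finset.sum_const, Finset.card_univ, nsmul_eq_mul]
    · refine (norm_le_sum_norm_apply _).trans ?_
      have hGj : IsSmooth (FunctionSpaces.Torus.gradient fun y => V y j) := (hVs.apply j).gradient
      calc ∑ i, ‖FunctionSpaces.Torus.partialDeriv l (FunctionSpaces.Torus.gradient fun y => V y j) x i‖
          ≤ ∑ _i : d, (ε ^ 2)⁻¹ * derivProfileMass d 2 * M := Finset.sum_le_sum fun i _ => by
            have hfun : (fun y => FunctionSpaces.Torus.gradient (fun y => V y j) y i) =
                fun y => FunctionSpaces.Torus.partialDeriv i V y j := by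
              funext y
              rw [FunctionSpaces.Torus.gradient_apply ((hVs.apply j).isContDiff (by simp)),
                FunctionSpaces.Torus.partialDeriv_apply_coord (hVs.isContDiff (by simp))]
            rw [← FunctionSpaces.Torus.partialDeriv_apply_coord (hGj.isContDiff (by simp)) l x i, hfun,
              FunctionSpaces.Torus.partialDeriv_apply_coord ((hVs.partialDeriv i).isContDiff (by simp)) l x j]
            exact norm_partialDeriv_partialDeriv_mollifiedField_apply_le hU hτ hε hε' t x l i j
        _ = _ := by rw [Finset.sum_const, Finset.card_univ, nsmul_eq_mul]
  calc ‖FunctionSpaces.Torus.partialDeriv l (fun y => V y j • V y) x +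
        -FunctionSpaces.Torus.partialDeriv l (fun y => mollifiedFlux (timeBump hτ) ε U t y j) x +
        -ν • FunctionSpaces.Torus.partialDeriv l (fun y => symGrad V y j) x‖
      ≤ ‖FunctionSpaces.Torus.partialDeriv l (fun y => V y j • V y) x‖ +
          ‖FunctionSpaces.Torus.partialDeriv l (fun y => mollifiedFlux (timeBump hτ) ε U t y j) x‖ +
          |ν| * ‖FunctionSpaces.Torus.partialDeriv l (fun y => symGrad V y j) x‖ := by
        refine (norm_add_le _ _).trans (add_le_add ((norm_add_le _ _).trans (add_le_add le_rfl ?_)) ?_)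
        · rw [norm_neg]
        · rw [norm_smul, Real.norm_eq_abs, abs_neg]
    _ ≤ _ := add_le_add (add_le_add h1 h2) (mul_le_mul_of_nonneg_left h3 (abs_nonneg ν))

/-- Sup (column) form: `‖∂ₗ (raw)‖ ≤` the column bound (the Pi norm over columns). [folklore] -/
theorem norm_partialDeriv_startStressRaw_le (hU : HolderSlabData U M H β T₀) (hτ : 0 < τ) (hε : 0 < ε)
    (hε' : ε ≤ 1 / 4) (ν : ℝ) {t : ℝ} (ht : Icc (t - τ) (t + τ) ⊆ Icc 0 T₀) (x : UnitAddTorus d) (l : d) :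
    ‖FunctionSpaces.Torus.partialDeriv l (startStressRaw (timeBump hτ) ε ν U t) x‖ ≤
      2 * (Fintype.card d * M) * (ε⁻¹ * gradProfileMass d * (H * max τ ε ^ β)) +
        Fintype.card d * (ε⁻¹ * gradProfileMass d * M ^ 2) +
        |ν| * (2 * (Fintype.card d * ((ε ^ 2)⁻¹ * derivProfileMass d 2 * M))) := by
  have hraws : IsSmooth (startStressRaw (timeBump hτ) ε ν U t) :=
    isSmooth_startStressRaw hU.measurable hU.bound hU.zero_off hε hε' t
  have h0 : 0 ≤ 2 * (Fintype.card d * M) * (ε⁻¹ * gradProfileMass d * (H * max τ ε ^ β)) +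
      Fintype.card d * (ε⁻¹ * gradProfileMass d * M ^ 2) +
      |ν| * (2 * (Fintype.card d * ((ε ^ 2)⁻¹ * derivProfileMass d 2 * M))) := by
    have := hU.M_nonneg; have := hU.H_nonneg; have := FunctionSpaces.Torus.gradProfileMass_nonneg (d := d)
    have := FunctionSpaces.Torus.derivProfileMass_nonneg (d := d) 2
    have : 0 ≤ max τ ε ^ β := Real.rpow_nonneg (le_max_of_le_left hτ.le) _
    positivity
  refine (pi_norm_le_iff_of_nonneg h0).2 fun j => ?_
  rw [partialDeriv_tensor_apply hraws]
  exact norm_partialDeriv_startStressRaw_apply_le hU hτ hε hε' ν ht x l j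

end RawDeriv

/-! ## The raw stress: time derivative -/

section RawTime

variable {U : ℝ → UnitAddTorus d → EuclideanSpace ℝ d} {M H β T₀ τ ε : ℝ}

/-- The gradient of a coordinate of the mollified field, as the vector of partial derivatives
(for every time). [folklore] -/
theorem gradient_mollifiedField_apply_eq (hU : HolderSlabData U M H β T₀) (hτ : 0 < τ) (hε : 0 < ε)
    (hε' : ε ≤ 1 / 4) (t : ℝ) (x : UnitAddTorus d) (j : d) :
    FunctionSpaces.Torus.gradient (fun y => mollifiedField (timeBump hτ) ε U t y j) x =
      WithLp.toLp 2 fun i => FunctionSpaces.Torus.partialDeriv i (mollifiedField (timeBump hτ) ε U t) x j := by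
  have hUi := integrable_uncurry_of_bounded hU.measurable hU.bound hU.zero_off
  have hVs : IsSmooth (mollifiedField (timeBump hτ) ε U t) := isSmooth_mollifiedField hUi hε hε' t
  ext i
  rw [FunctionSpaces.Torus.gradient_apply ((hVs.apply j).isContDiff (by simp)),
    FunctionSpaces.Torus.partialDeriv_apply_coord (hVs.isContDiff (by simp))]

/-- **Time derivative of the raw stress columns**: `s ↦ (V ⊗ V - 𝒯 - ν(∇V + ∇Vᵀ))(s, x) j` is
differentiable with
`‖d/ds‖ ≤ 2dM·cτ⁻¹M + d·cτ⁻¹M² + |ν|·2d·cτ⁻¹C₁ε⁻¹M` (sup form of Buckmaster–Vicol (2.13), time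
part). [cite: BuckmasterVicol2019Annals, §2.5 (2.13)] -/
theorem norm_deriv_startStressRaw_apply_le (hU : HolderSlabData U M H β T₀) (hτ : 0 < τ) (hε : 0 < ε)
    (hε' : ε ≤ 1 / 4) (ν : ℝ) (t : ℝ) (x : UnitAddTorus d) (j : d) :
    ∃ D : EuclideanSpace ℝ d, HasDerivAt (fun s => startStressRaw (timeBump hτ) ε ν U s x j) D t ∧
      ‖D‖ ≤ 2 * (Fintype.card d * M) * (τ⁻¹ * timeBumpDerivMass * M) +
        Fintype.card d * (τ⁻¹ * timeBumpDerivMass * M ^ 2) +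
        |ν| * (2 * (Fintype.card d * (τ⁻¹ * timeBumpDerivMass * (ε⁻¹ * gradProfileMass d) * M))) := by
  have hUm := hU.measurable
  have hUi := integrable_uncurry_of_bounded hU.measurable hU.bound hU.zero_off
  obtain ⟨hcm, hcb, hc0⟩ := hU.column j
  have hUi' := integrable_uncurry_of_bounded hcm hcb hc0
  set V := mollifiedField (timeBump hτ) ε U with hV
  -- (1) the velocity and its `j`-th coordinate
  have hdV := hasDerivAt_mollifiedField (φ := timeBump hτ) hUm hUi hε hε' t x
  have hdVj := hasDerivAt_mollifiedField_apply (φ := timeBump hτ) hUm hUi hε hε' t x j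
  set V' : EuclideanSpace ℝ d := WithLp.toLp 2 fun i => timeAvgWith (deriv ((timeBump hτ).normed volume))
    (fun s => (fun y => U s y i) ⋆ kernel ε) t x with hV'
  have hV'eq : V' = FunctionSpaces.Torus.timeDeriv V t x := by
    rw [FunctionSpaces.Torus.timeDeriv, hdV.deriv]
  have hV'b : ‖V'‖ ≤ Fintype.card d * (τ⁻¹ * timeBumpDerivMass * M) := by
    rw [hV'eq]; exact norm_timeDeriv_mollifiedField_le hU hτ hε hε' t x
  have hV'jb : ‖V' j‖ ≤ τ⁻¹ * timeBumpDerivMass * M := by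
    rw [hV'eq]; exact norm_timeDeriv_mollifiedField_apply_le hU hτ hε hε' t x j
  have ha : HasDerivAt (fun s => V s x j • V s x) (V t x j • V' + V' j • V t x) t := hdVj.smul hdV
  -- (2) the flux column
  have hdT := hasDerivAt_mollifiedField (φ := timeBump hτ) hcm hUi' hε hε' t x
  set T' : EuclideanSpace ℝ d := WithLp.toLp 2 fun i => timeAvgWith (deriv ((timeBump hτ).normed volume))
    (fun s => (fun y => (U s y j • U s y) i) ⋆ kernel ε) t x with hT'
  have hT'b : ‖T'‖ ≤ Fintype.card d * (τ⁻¹ * timeBumpDerivMass * M ^ 2) := by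
    have hT'eq : T' = FunctionSpaces.Torus.timeDeriv (fun τ' y => mollifiedFlux (timeBump hτ) ε U τ' y j) t x := by
      have hfun : (fun τ' y => mollifiedFlux (timeBump hτ) ε U τ' y j) = mollifiedField (timeBump hτ) ε (fun s y => U s y j • U s y) := by
        funext τ' y; rw [mollifiedFlux_apply]
      rw [hfun, FunctionSpaces.Torus.timeDeriv, hdT.deriv]
    rw [hT'eq]
    refine (norm_le_sum_norm_apply _).trans ?_
    calc ∑ i, ‖FunctionSpaces.Torus.timeDeriv (fun τ' y => mollifiedFlux (timeBump hτ) ε U τ' y j) t x i‖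
        ≤ ∑ _i : d, τ⁻¹ * timeBumpDerivMass * M ^ 2 :=
          Finset.sum_le_sum fun i _ => norm_timeDeriv_mollifiedFlux_apply_le hU hτ hε hε' t x j i
      _ = _ := by rw [Finset.sum_const, Finset.card_univ, nsmul_eq_mul]
  have hb : HasDerivAt (fun s => mollifiedFlux (timeBump hτ) ε U s x j) T' t := by
    have hfun : (fun s => mollifiedFlux (timeBump hτ) ε U s x j) = fun s => mollifiedField (timeBump hτ) ε (fun s y => U s y j • U s y) s x := by
      funext s; rw [mollifiedFlux_apply]
    rw [hfun]; exact hdT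
  -- (3) the symmetric gradient column
  set P' : EuclideanSpace ℝ d := WithLp.toLp 2 fun i => timeAvgWith (deriv ((timeBump hτ).normed volume))
    (fun s => (fun y => U s y i) ⋆ FunctionSpaces.Torus.partialDeriv j (kernel ε)) t x with hP'
  set Q' : EuclideanSpace ℝ d := WithLp.toLp 2 fun i => timeAvgWith (deriv ((timeBump hτ).normed volume))
    (fun s => (fun y => U s y j) ⋆ FunctionSpaces.Torus.partialDeriv i (kernel ε)) t x with hQ'
  have hP : HasDerivAt (fun s => FunctionSpaces.Torus.partialDeriv j (V s) x) P' t :=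
    hasDerivAt_of_apply fun i => hasDerivAt_partialDeriv_mollifiedField_apply (φ := timeBump hτ) hUm hU.bound hU.zero_off hε hε' t x j i
  have hQ : HasDerivAt (fun s => FunctionSpaces.Torus.gradient (fun y => V s y j) x) Q' t := by
    have hfun : (fun s => FunctionSpaces.Torus.gradient (fun y => V s y j) x) =
        fun s => WithLp.toLp 2 fun i => FunctionSpaces.Torus.partialDeriv i (V s) x j :=
      funext fun s => gradient_mollifiedField_apply_eq hU hτ hε hε' s x j
    rw [hfun]
    exact hasDerivAt_of_apply fun i => hasDerivAt_partialDeriv_mollifiedField_apply (φ := timeBump hτ) hUm hU.bound hU.zero_off hε hε' t x i j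
  have hKb : ∀ i, ‖P' i‖ ≤ τ⁻¹ * timeBumpDerivMass * (ε⁻¹ * gradProfileMass d) * M ∧
      ‖Q' i‖ ≤ τ⁻¹ * timeBumpDerivMass * (ε⁻¹ * gradProfileMass d) * M := by
    intro i
    constructor
    · have h := norm_timeDeriv_partialDeriv_mollifiedField_apply_le hU hτ hε hε' t x j i
      rwa [timeDeriv_partialDeriv_mollifiedField_apply hUm hU.bound hU.zero_off hε hε'] at h
    · have h := norm_timeDeriv_partialDeriv_mollifiedField_apply_le hU hτ hε hε' t x i j
      rwa [timeDeriv_partialDeriv_mollifiedField_apply hUm hU.bound hU.zero_off hε hε'] at h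
  have hPQb : ‖P' + Q'‖ ≤ 2 * (Fintype.card d * (τ⁻¹ * timeBumpDerivMass * (ε⁻¹ * gradProfileMass d) * M)) := by
    rw [two_mul]
    refine (norm_add_le _ _).trans (add_le_add ?_ ?_) <;> refine (norm_le_sum_norm_apply _).trans ?_
    · calc ∑ i, ‖P' i‖ ≤ ∑ _i : d, τ⁻¹ * timeBumpDerivMass * (ε⁻¹ * gradProfileMass d) * M :=
            Finset.sum_le_sum fun i _ => (hKb i).1
        _ = _ := by rw [Finset.sum_const, Finset.card_univ, nsmul_eq_mul]
    · calc ∑ i, ‖Q' i‖ ≤ ∑ _i : d, τ⁻¹ * timeBumpDerivMass * (ε⁻¹ * gradProfileMass d) * M :=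
            Finset.sum_le_sum fun i _ => (hKb i).2
        _ = _ := by rw [Finset.sum_const, Finset.card_univ, nsmul_eq_mul]
  have hg : HasDerivAt (fun s => symGrad (V s) x j) (P' + Q') t := hP.add hQ
  -- assemble
  refine ⟨V t x j • V' + V' j • V t x - T' - ν • (P' + Q'), (ha.sub hb).sub (hg.const_smul ν), ?_⟩
  have hVx : ‖V t x‖ ≤ Fintype.card d * M := (norm_mollifiedField_bounds hU hτ hε hε').1 t x
  have hVxj : ‖V t x j‖ ≤ M := norm_mollifiedField_apply_le hU hτ hε hε' t x j
  have hM := hU.M_nonneg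
  have hc := FunctionSpaces.Torus.timeBumpDerivMass_nonneg
  calc ‖V t x j • V' + V' j • V t x - T' - ν • (P' + Q')‖
      ≤ ‖V t x j • V'‖ + ‖V' j • V t x‖ + ‖T'‖ + ‖ν • (P' + Q')‖ := by
        refine (norm_sub_le _ _).trans (add_le_add ((norm_sub_le _ _).trans (add_le_add (norm_add_le _ _) le_rfl)) le_rfl)
    _ ≤ M * (Fintype.card d * (τ⁻¹ * timeBumpDerivMass * M)) + τ⁻¹ * timeBumpDerivMass * M * (Fintype.card d * M) +
          Fintype.card d * (τ⁻¹ * timeBumpDerivMass * M ^ 2) +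
          |ν| * (2 * (Fintype.card d * (τ⁻¹ * timeBumpDerivMass * (ε⁻¹ * gradProfileMass d) * M))) := by
        refine add_le_add (add_le_add (add_le_add ?_ ?_) hT'b) ?_
        · rw [norm_smul]; exact mul_le_mul hVxj hV'b (norm_nonneg _) hM
        · rw [norm_smul]; exact mul_le_mul hV'jb hVx (norm_nonneg _) (by positivity)
        · rw [norm_smul, Real.norm_eq_abs]; exact mul_le_mul_of_nonneg_left hPQb (abs_nonneg ν)
    _ = _ := by ring

end RawTime

/-! ## The stress of the start: sup, space and time derivative bounds -/

section Stress

variable {U : ℝ → UnitAddTorus d → EuclideanSpace ℝ d} {M H β T₀ τ ε : ℝ}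

/-- **`‖R̊(t, x)‖`** for the shifted stress of the start, on windows inside the slab. [cite: BuckmasterVicol2019Annals, §2.5 (2.12)] -/
theorem norm_startStress_le (hU : HolderSlabData U M H β T₀) (hτ : 0 < τ) (hε : 0 < ε) (hε' : ε ≤ 1 / 4) (ν : ℝ)
    {t₀ t : ℝ} (ht : Icc (t + t₀ - τ) (t + t₀ + τ) ⊆ Icc 0 T₀) (x : UnitAddTorus d) :
    ‖startStress (timeBump hτ) ε ν U t₀ t x‖ ≤ (Fintype.card d + 1) *
      (Fintype.card d * (4 * M * H * max τ ε ^ β) +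
        |ν| * (2 * (Fintype.card d * (ε⁻¹ * gradProfileMass d * (H * max τ ε ^ β))))) :=
  norm_traceless_startStressRaw_le hU hτ hε hε' ν ht x

/-- **`‖∂ₗ R̊(t, x)‖`** for the shifted stress of the start, on windows inside the slab. [cite: BuckmasterVicol2019Annals, §2.5 (2.13)] -/
theorem norm_partialDeriv_startStress_le (hU : HolderSlabData U M H β T₀) (hτ : 0 < τ) (hε : 0 < ε)
    (hε' : ε ≤ 1 / 4) (ν : ℝ) {t₀ t : ℝ} (ht : Icc (t + t₀ - τ) (t + t₀ + τ) ⊆ Icc 0 T₀) (x : UnitAddTorus d) (l : d) :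
    ‖FunctionSpaces.Torus.partialDeriv l (startStress (timeBump hτ) ε ν U t₀ t) x‖ ≤ (Fintype.card d + 1) *
      (2 * (Fintype.card d * M) * (ε⁻¹ * gradProfileMass d * (H * max τ ε ^ β)) +
        Fintype.card d * (ε⁻¹ * gradProfileMass d * M ^ 2) +
        |ν| * (2 * (Fintype.card d * ((ε ^ 2)⁻¹ * derivProfileMass d 2 * M)))) := by
  have hraws : IsSmooth (startStressRaw (timeBump hτ) ε ν U (t + t₀)) :=
    isSmooth_startStressRaw hU.measurable hU.bound hU.zero_off hε hε' (t + t₀)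
  show ‖FunctionSpaces.Torus.partialDeriv l (traceless (startStressRaw (timeBump hτ) ε ν U (t + t₀))) x‖ ≤ _
  rw [traceless_eq_comp, FunctionSpaces.Torus.partialDeriv_clm_comp hraws]
  exact (norm_tracelessCLM_le _).trans (mul_le_mul_of_nonneg_left
    (norm_partialDeriv_startStressRaw_le hU hτ hε hε' ν ht x l) (by positivity))

/-- **`∂ₜ R̊(t, x)` exists and is bounded** for the shifted stress of the start (two-sided
derivative in `t`, at every `t`). [cite: BuckmasterVicol2019Annals, §2.5 (2.13)] -/
theorem hasDerivAt_startStress (hU : HolderSlabData U M H β T₀) (hτ : 0 < τ) (hε : 0 < ε)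
    (hε' : ε ≤ 1 / 4) (ν : ℝ) (t₀ t : ℝ) (x : UnitAddTorus d) :
    ∃ D : d → EuclideanSpace ℝ d, HasDerivAt (fun s => startStress (timeBump hτ) ε ν U t₀ s x) D t ∧
      ‖D‖ ≤ (Fintype.card d + 1) *
        (2 * (Fintype.card d * M) * (τ⁻¹ * timeBumpDerivMass * M) +
          Fintype.card d * (τ⁻¹ * timeBumpDerivMass * M ^ 2) +
          |ν| * (2 * (Fintype.card d * (τ⁻¹ * timeBumpDerivMass * (ε⁻¹ * gradProfileMass d) * M)))) := by
  set B : ℝ := 2 * (Fintype.card d * M) * (τ⁻¹ * timeBumpDerivMass * M) +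
        Fintype.card d * (τ⁻¹ * timeBumpDerivMass * M ^ 2) +
        |ν| * (2 * (Fintype.card d * (τ⁻¹ * timeBumpDerivMass * (ε⁻¹ * gradProfileMass d) * M))) with hB
  have hB0 : 0 ≤ B := by
    have := hU.M_nonneg; have := FunctionSpaces.Torus.gradProfileMass_nonneg (d := d)
    have := FunctionSpaces.Torus.timeBumpDerivMass_nonneg
    positivity
  -- the column derivatives at the shifted time
  have hcol := fun j => norm_deriv_startStressRaw_apply_le hU hτ hε hε' ν (t + t₀) x j
  choose D hD hDb using hcol
  have hraw : HasDerivAt (fun s => startStressRaw (timeBump hτ) ε ν U (s + t₀) x) (fun j => D j) t := by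
    refine hasDerivAt_pi.2 fun j => ?_
    exact HasDerivAt.comp_add_const t t₀ (hD j)
  have hDnorm : ‖(fun j => D j : d → EuclideanSpace ℝ d)‖ ≤ B := (pi_norm_le_iff_of_nonneg hB0).2 fun j => hDb j
  have hL := (tracelessCLM (d := d)).hasFDerivAt.comp_hasDerivAt t hraw
  have hfun : (fun s => startStress (timeBump hτ) ε ν U t₀ s x) = tracelessCLM ∘ fun s => startStressRaw (timeBump hτ) ε ν U (s + t₀) x := by
    funext s
    show traceless (startStressRaw (timeBump hτ) ε ν U (s + t₀)) x = _
    rw [traceless_eq_comp]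
    rfl
  refine ⟨tracelessCLM (fun j => D j), ?_, (norm_tracelessCLM_le _).trans (mul_le_mul_of_nonneg_left hDnorm (by positivity))⟩
  rw [hfun]
  exact hL

/-- **`‖∂ₜ R̊(t, x)‖`** for the shifted stress of the start (two-sided time derivative). [cite: BuckmasterVicol2019Annals, §2.5 (2.13)] -/
theorem norm_timeDeriv_startStress_le (hU : HolderSlabData U M H β T₀) (hτ : 0 < τ) (hε : 0 < ε)
    (hε' : ε ≤ 1 / 4) (ν : ℝ) (t₀ t : ℝ) (x : UnitAddTorus d) :
    ‖FunctionSpaces.Torus.timeDeriv (startStress (timeBump hτ) ε ν U t₀) t x‖ ≤ (Fintype.card d + 1) *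
      (2 * (Fintype.card d * M) * (τ⁻¹ * timeBumpDerivMass * M) +
        Fintype.card d * (τ⁻¹ * timeBumpDerivMass * M ^ 2) +
        |ν| * (2 * (Fintype.card d * (τ⁻¹ * timeBumpDerivMass * (ε⁻¹ * gradProfileMass d) * M)))) := by
  obtain ⟨D, hD, hDb⟩ := hasDerivAt_startStress hU hτ hε hε' ν t₀ t x
  rw [FunctionSpaces.Torus.timeDeriv, hD.deriv]
  exact hDb

end Stress

/-! ## Zero mean is preserved by the space–time mollification -/

section ZeroMean

variable {U : ℝ → UnitAddTorus d → EuclideanSpace ℝ d} {φ : ContDiffBump (0 : ℝ)} {ε M T₀ : ℝ}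

omit [DecidableEq d] in
/-- Time averages of fields with mean-free slices are mean free (Fubini on `ℝ × T^d`). [folklore] -/
theorem integral_timeAvgWith_eq_zero {F : Type*} [NormedAddCommGroup F] [NormedSpace ℝ F] [CompleteSpace F]
    {G : ℝ → UnitAddTorus d → F} (hG : Integrable (uncurry G) ((volume : Measure ℝ).prod volume)) {r : ℝ → ℝ}
    (hr : Continuous r) (hrc : HasCompactSupport r) (h0 : ∀ s, ∫ y, G s y = 0) (t : ℝ) :
    ∫ y, timeAvgWith r G t y = 0 := by
  have h : Integrable (uncurry fun (y : UnitAddTorus d) (s : ℝ) => r s • G (t - s) y)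
      ((volume : Measure (UnitAddTorus d)).prod (volume : Measure ℝ)) :=
    (FunctionSpaces.Torus.integrable_kernel_smul_timeShift hG hr hrc t).swap
  have h1 : (fun y => timeAvgWith r G t y) = fun y => ∫ s, r s • G (t - s) y := by
    funext y; exact FunctionSpaces.timeAvgWith_apply r G t y
  rw [h1, integral_integral_swap h]
  have h2 : (fun s => ∫ y, r s • G (t - s) y) = fun _ => (0 : F) := by
    funext s
    rw [integral_smul, h0 (t - s), smul_zero]
  rw [h2, integral_zero]

omit [DecidableEq d] in
/-- **The mollified field of mean-free data is mean free** at every time. [folklore] -/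
theorem hasZeroMean_mollifiedField (hUm : StronglyMeasurable (uncurry U)) (hUb : ∀ s y, ‖U s y‖ ≤ M)
    (hU0 : ∀ s, s ∉ Icc 0 T₀ → U s = 0) (hmean : ∀ s, FunctionSpaces.Torus.HasZeroMean (U s)) (hε : 0 < ε)
    (hε' : ε ≤ 1 / 4) (t : ℝ) : FunctionSpaces.Torus.HasZeroMean (mollifiedField φ ε U t) := by
  classical
  have hUi := integrable_uncurry_of_bounded hUm hUb hU0
  have hVi : Integrable (mollifiedField φ ε U t) volume :=
    (isSmooth_mollifiedField hUi hε hε' t).continuous.integrable_unitAddTorus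
  -- components of the data are mean free
  have h0 : ∀ i s, ∫ y, U s y i = 0 := by
    intro i s
    have h := (EuclideanSpace.proj i : EuclideanSpace ℝ d →L[ℝ] ℝ).integral_comp_comm (integrable_slice hUm hUb s)
    have h' : ∫ y, U s y i = (∫ y, U s y) i := h
    rw [h', hmean s]
    rfl
  -- components of the mollified field are mean free
  have hi : ∀ i, ∫ x, mollifiedField φ ε U t x i = 0 := by
    intro i
    have hUii : Integrable (uncurry fun s y => U s y i) ((volume : Measure ℝ).prod volume) :=
      (EuclideanSpace.proj i : EuclideanSpace ℝ d →L[ℝ] ℝ).integrable_comp hUi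
    have hf : Integrable (timeAvgWith (φ.normed volume) (fun s y => U s y i) t) volume :=
      FunctionSpaces.Torus.integrable_timeAvgWith hUii φ.continuous_normed φ.hasCompactSupport_normed t
    have hk : Integrable (kernel ε) (volume : Measure (UnitAddTorus d)) :=
      (FunctionSpaces.Torus.continuous_kernel hε hε').integrable_unitAddTorus
    have hfun : (fun x => mollifiedField φ ε U t x i) = (timeAvgWith (φ.normed volume) (fun s y => U s y i) t) ⋆ kernel ε :=
      mollifiedField_apply_fun φ ε U t i
    rw [hfun, integral_convolution (L := ContinuousLinearMap.lsmul ℝ ℝ) hf hk,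
      integral_timeAvgWith_eq_zero hUii φ.continuous_normed φ.hasCompactSupport_normed (h0 i) t]
    simp
  unfold FunctionSpaces.Torus.HasZeroMean
  ext i
  have h := (EuclideanSpace.proj i : EuclideanSpace ℝ d →L[ℝ] ℝ).integral_comp_comm hVi
  have h' : ∫ x, mollifiedField φ ε U t x i = (∫ x, mollifiedField φ ε U t x) i := h
  rw [← h', hi i]
  rfl

end ZeroMean

end Torus

end Literature.Analysis.FluidPDE

end
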